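import Summits.BirchSwinnertonDyer.BirchSwinnertonDyer.Theorems.EisensteinPrimesKatzLineIntFrame
import Summits.BirchSwinnertonDyer.BirchSwinnertonDyer.Theorems.EisensteinPrimesGoodLatticeMuLambdaSplit
import HarnessLib

/-!
# AN-F₁ at the Teichmüller pair of the good lattice: the hypotheses on `θ_K` DISCHARGED
# (helper file for crux 2 `GoodLatticeBDPValue`, stmt-BirchSwinnertonDyer-19032, line `halves`, stub 3
# `stub_anDS`, piece AN-F₁ `KatzLineIntFrameAt`; seat `bsd-line-x1-p1-w2` gen 2)

`…KatzLineIntFrame.exists_katzLineIntFrame` proves AN-F₁ for a Hecke character `θ_K` that is of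
finite order, `c`-invariant and unramified at `v`, `v̄`. Here these are DISCHARGED for the character the
line actually uses — the Hecke character `θ_K` (`IsHeckeCharOf ι' (𝟙̃|_{Γ_K}) θ_K`) of the quotient
Teichmüller character `𝟙̃ : Γ_ℚ → GL₁(ℤ_p)` of the good lattice at a good anomalous Eisenstein prime,
restricted to `K` — which is the currency in which the consumer `goodLatticeMuLambdaOnTree_of_splitDSFree`
feeds `stub_anDS` (pair `exists_teichmullerPair` over `ℚ`, restricted by `isResidualPairOver_restrictField`)
and the currency of the [BRω] shape `GoodLatticeOmegaSideDSOnTreeFree`: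

* finite order: arithmetic reciprocity gives a finite-order witness (`exists_heckeCharacter_of_pow_eq_one`)
  and the Hecke character attached to `𝟙̃|_{Γ_K}` is unique (`IsHeckeCharOf.unique_of_restrictField`);
* `c`-invariance: `IsHeckeCharOf.galConj_eq_of_restrictField` (base change from `ℚ`);
* unramified at `v`, `v̄`: `𝟙̃` is unramified at `p` ([LOCp], `goodLatticeQuotCharUnramifiedAtPOnTree_holds`)
  and away from `N` (Néron–Ogg–Shafarevich, `isUnramifiedAt_of_isTeichmullerLiftOnQuot`), read on `θ_K`
  by `IwasawaTwoVariable.isUnramifiedAt_of_natCast_mem`;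
* the structure map: `R1.toCpInt p`.

RESULT `katzLineIntFrame_of_teichmullerPair`: the statement of `KatzLineIntFrameAt` (idea-11 g5 rev 2,
`Cruxes/GoodLatticeBDPValue/Lines/halves_anDS_split_idea11g4.lean`) with its residual-pair binders typed
OVER `ℚ` (a rational `p`-line `Φ`, its Teichmüller pair `(ω̃, 𝟙̃)`, `θ_K` of `𝟙̃|_{Γ_K}` — the binder block
of `GoodLatticeOmegaSideDSOnTreeFree`) and the conclusion unfolded (`IsKatzLFunctionInt`,
`IntFirstUnitCoeffAt` are not tree definitions): GRANTED de Shalit II.6.4 (PUBLISHED, hypothesis `hF`).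
What is NOT here: the K-level form with an arbitrary residual pair `IsResidualPairOver (W/K) p θsub θquot`
(needs: the quotient character of a `Γ_K`-stable `p`-line of `E[p]`, `E/ℚ`, is a restriction from `Γ_ℚ`
— Jordan–Hölder over `ℚ` vs `K`; not in the tree) and AN-F₂ (`R₀`-valuedness). No definition, no
`sorry`; nothing about BSD, IMC2 or KY Thm. 3.0.8 is proved.
References: de Shalit 1987 II.6.4, II.4.16; CGLS 2022 Thm. 2.1.2; Serre 1968 Ch. I §2.1; Cassels–Fröhlich VII §4.
-/

-- the summit namespace `Summit.BirchSwinnertonDyer.BirchSwinnertonDyer` repeats the problem name by design (D-0017)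
set_option linter.dupNamespace false
set_option autoImplicit false

noncomputable section

open scoped Classical Topology

open Filter WeierstrassCurve NumberField IsDedekindDomain Field PowerSeries
  Literature.NumberTheory.EllipticCurves Literature.NumberTheory.EllipticCurves.Rank1Residual
  Literature.NumberTheory.GaloisRepresentations Literature.NumberTheory.GaloisRepresentations.HeckeCharacter
  Literature.NumberTheory.Automorphic Literature.NumberTheory.QuadraticFields
  Literature.NumberTheory.EllipticCurves.CastellaGrossiLeeSkinner2022
  Literature.NumberTheory.EllipticCurves.KellerYin2024
  Literature.NumberTheory.EllipticCurves.Rubin1991 Literature.NumberTheory.EllipticCurves.DeShalit1987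
  Literature.NumberTheory.EllipticCurves.Hida2010MuInvariant
  Summit.BirchSwinnertonDyer.Rank1Residual.X11b Summit.BirchSwinnertonDyer.Rank1Residual.X11b.Three.LambdaSupply
  Summit.BirchSwinnertonDyer.BirchSwinnertonDyer.Theorems.IwasawaTwoVariable
  Summit.BirchSwinnertonDyer.BirchSwinnertonDyer.Theorems.EisensteinPrimesMuLambda
  Summit.BirchSwinnertonDyer.Rank1Residual.X1.KellerYinMuLambdaSplit

namespace Summit.BirchSwinnertonDyer.BirchSwinnertonDyer.Theorems.KatzLineFrame

/-- **The Hecke character of `𝟙̃|_{Γ_K}` is of finite order, `c`-invariant and unramified above `p`.**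
For `E/ℚ`, a good anomalous Eisenstein prime `p > 2` with no unramified rational `p`-line, a rational
`p`-line `Φ` with quotient Teichmüller character `𝟙̃ = θquot : Γ_ℚ → GL₁(ℤ_p)`, `K` a CM number field and
`θ_K` any Hecke character with `IsHeckeCharOf ι' (𝟙̃|_{Γ_K}) θ_K`: `θ_K` has finite order
(reciprocity witness + uniqueness), `θ_K ∘ c = θ_K` (base change), and `θ_K` is unramified at every
place above `p` ([LOCp]) — the three displayed hypotheses of `exists_katzLineIntFrame`.
[cite: CasselsFrohlichANT1967, Ch. VII §5.1 Main Theorem and §4 Prop. 4.1]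
[cite: SerreAbelianLadic1968, Ch. I §2.1] [cite: KellerYin2024, Prop. 1.3.1 and §1.4 (arXiv:2402.12781v2 TeX L877, L1087)] -/
theorem heckeCharOf_quotChar_finiteOrder_galConj_unramified (W : WeierstrassCurve ℚ) [W.IsElliptic]
    [W.IsGloballyMinimal] (p : ℕ) [Fact p.Prime] (hp : 2 < p) (hgood : Good W p) (hred : Red W p)
    (hanom : Anom W p)
    (hGL : ∀ Φ : AddSubgroup (geomTorsion W (p : ℤ)), IsRationalLine W p Φ → ¬ LineUnramifiedAt W p Φ)
    {K : Type} [Field K] [NumberField K] [IsCMField K] (ι' : PadicAlgCl p ≃+* ℂ)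
    {Φ : AddSubgroup (geomTorsion W (p : ℤ))} (hΦ : IsRationalLine W p Φ)
    {θquot : FramedGaloisRep ℚ (padicCoeffIntegers (∅ : Set (PadicAlgCl p))) 1}
    (hquot : IsTeichmullerLiftOnQuot (∅ : Set (PadicAlgCl p)) (Φ.map (geomTorsion W (p : ℤ)).subtype)
      (geomTorsion W (p : ℤ)) θquot)
    {θK : HeckeCharacter K} (hθK : IsHeckeCharOf ι' (θquot.restrictField K) θK) :
    θK.IsFiniteOrder ∧ HeckeCharacter.galConj (IsCMField.complexConj K) θK = θK ∧
      ∀ w : HeightOneSpectrum (𝓞 K), ((p : ℕ) : 𝓞 K) ∈ w.asIdeal → θK.IsUnramifiedAt w := by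
  -- `𝟙̃` is Teichmüller, unramified at `p` ([LOCp]) and away from `N` (Néron–Ogg–Shafarevich)
  have hT1K : ∀ σ : absoluteGaloisGroup K, θquot.restrictField K σ ^ (p - 1) = 1 := fun σ ↦ hquot.1 _
  have hcardΦ : Nat.card (Φ.map (geomTorsion W (p : ℤ)).subtype) = p := by
    rw [Nat.card_congr (Φ.equivMapOfInjective (geomTorsion W (p : ℤ)).subtype
      (geomTorsion W (p : ℤ)).subtype_injective).toEquiv.symm, hΦ.1]
  have hunrp : ∀ u : HeightOneSpectrum (𝓞 ℚ), ((p : ℕ) : 𝓞 ℚ) ∈ u.asIdeal → θquot.IsUnramifiedAt u :=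
    goodLatticeQuotCharUnramifiedAtPOnTree_holds W p hp hgood hred hanom hGL Φ hΦ θquot hquot
  have hunr : ∀ u : HeightOneSpectrum (𝓞 ℚ), ((W.conductorNorm ℤ : ℤ) : 𝓞 ℚ) ∉ u.asIdeal →
      θquot.IsUnramifiedAt u := by
    intro u hu
    by_cases hpu : ((p : ℕ) : 𝓞 ℚ) ∈ u.asIdeal
    · exact hunrp u hpu
    · exact isUnramifiedAt_of_isTeichmullerLiftOnQuot W ∅ hcardΦ hquot
        (hasGoodReductionAt_of_conductorNorm_notMem W u hu) hpu
  have hev : ∀ᶠ u : HeightOneSpectrum (𝓞 ℚ) in cofinite, θquot.IsUnramifiedAt u :=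
    eventually_isUnramifiedAt_of_forall_not_mem θquot (W.conductorNorm_pos_holds).ne' hunr
  -- finite order by uniqueness, `c`-invariance by base change, unramified above `p`
  obtain ⟨θK₀, hfin₀, hθK₀'⟩ := exists_heckeCharacter_of_pow_eq_one ∅ ι' (θquot.restrictField K) hT1K
  have hθK₀ : IsHeckeCharOf ι' (θquot.restrictField K) θK₀ := hθK₀'
  have heq : θK = θK₀ := hθK.unique_of_restrictField ι' hev hθK₀
  refine ⟨heq ▸ hfin₀, hθK.galConj_eq_of_restrictField ι' hev _, fun w hw ↦ ?_⟩
  exact isUnramifiedAt_of_natCast_mem hunrp hθK hw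

/-- **AN-F₁ at the Teichmüller pair of the good lattice** (the statement of the idea file's
`KatzLineIntFrameAt`, residual-pair binders typed over `ℚ` as in `GoodLatticeOmegaSideDSOnTreeFree`,
conclusion unfolded), GRANTED de Shalit II.6.4 (`hF`, PUBLISHED): on the data — `2 < p` good, reducible,
anomalous, no unramified rational `p`-line; `K` imaginary quadratic with (Heeg) for `N_E` and `p`, `D_K`
odd, `≠ −3`; `v` read through `ι` and through `ι'`, `v̄` the other prime; `κ` anticyclotomic with top
generator `γ`; a rational `p`-line `Φ` with Teichmüller pair `(θsub, θquot)`; `θ_K` the Hecke character of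
`θquot|_{Γ_K}`; `S` its exact ramification set; a generator pair `(κ, κ'; γ, γ')`; de Shalit data
`(Ω, δ, Ω_p)`; a two-variable frame `G` of `θ_K⁻¹` at `(γ⁻¹, γ'⁻¹)`; `g ∈ ℤ_p⟦S⟧⟦T⟧` with `J(g) ~ G` along
every structure map and `g(S=0) mod p ≠ 0` — THERE ARE `Ω_K' ≠ 0`, `Ω_p'` with `‖Ω_p'‖ = 1` and
`Q ∈ 𝓞_{ℂ_p}⟦T⟧` carrying the CGLS interpolation property of `θ_K` at `γ` (`Cbar = ∅`) on every CGLS datum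
and having first unit coefficient at `ord(g(S=0) mod p)`. Composition of
`heckeCharOf_quotChar_finiteOrder_galConj_unramified` and `exists_katzLineIntFrame`; nothing asserted
about `R₀`-valuedness (AN-F₂). [cite: deShalit1987, II.6.4 Theorem (i) (9), (14)–(15); II.4.16 (49)–(50)]
[cite: CastellaGrossiLeeSkinner2022, Thm. 2.1.2 (arXiv:2008.02571v2 TeX L1015–1041)]
[cite: KellerYin2024, Thms. 2.2.1–2.2.2 (arXiv:2402.12781v2 TeX L1426–1448)] -/
theorem katzLineIntFrame_of_teichmullerPair (hF : thmII64_katzMeasure₂_functionalEquation)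
    (W : WeierstrassCurve ℚ) [W.IsElliptic] [W.IsGloballyMinimal] (p : ℕ) [Fact p.Prime] :
    2 < p → Good W p → Red W p → Anom W p →
    (∀ Φ : AddSubgroup (geomTorsion W (p : ℤ)), IsRationalLine W p Φ → ¬ LineUnramifiedAt W p Φ) →
    ∀ (K : Type) [Field K] [NumberField K], IsImaginaryQuadratic K →
      SatisfiesHeegnerHypothesis (W.conductorNorm ℤ) K → SatisfiesHeegnerHypothesis p K →
      Odd (NumberField.discr K) → NumberField.discr K ≠ -3 →
    ∀ (ι : K →+* ℚ_[p]) (v vbar : HeightOneSpectrum (𝓞 K)),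
      (∀ x : 𝓞 K, x ∈ v.asIdeal ↔ ‖ι (x : K)‖ < 1) →
      ((p : ℕ) : 𝓞 K) ∈ vbar.asIdeal → vbar ≠ v →
    ∀ (κ : ZpExtension K p), κ.IsAnticyclotomic →
    ∀ (γ : absoluteGaloisGroup K) [Fact (κ.IsTopGenerator γ)],
    ∀ (ι' : PadicAlgCl p ≃+* ℂ),
      (∀ (w : InfinitePlace K) (k : 𝓞 K), k ∈ v.asIdeal ↔ ‖ι'.symm (w.embedding (k : K))‖ < 1) →
    ∀ (Φ : AddSubgroup (geomTorsion W (p : ℤ))), IsRationalLine W p Φ →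
    ∀ (θsub θquot : FramedGaloisRep ℚ (padicCoeffIntegers (∅ : Set (PadicAlgCl p))) 1),
      IsTeichmullerLiftOn (∅ : Set (PadicAlgCl p)) (Φ.map (geomTorsion W (p : ℤ)).subtype) θsub →
      IsTeichmullerLiftOnQuot (∅ : Set (PadicAlgCl p)) (Φ.map (geomTorsion W (p : ℤ)).subtype)
        (geomTorsion W (p : ℤ)) θquot →
    ∀ (θK : HeckeCharacter K), IsHeckeCharOf ι' (θquot.restrictField K) θK →
    ∀ (S : Finset (HeightOneSpectrum (𝓞 K))),
      (∀ w : HeightOneSpectrum (𝓞 K), w ∈ S ↔ ¬ θK.IsUnramifiedAt w) →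
    ∀ (κ' : ZpExtension K p) (γ' : absoluteGaloisGroup K), ZpExtension.IsTopGeneratorPair κ κ' γ γ' →
    ∀ (Ω δ : ℂ) (Ωp : (unrIntegers p)ˣ) (G : PowerSeries (PowerSeries (PadicComplexInt p)))
      (g : IwasawaAlgebra₂ p), Ω ≠ 0 →
      (δ ^ 2 = (NumberField.discr K : ℂ) ∨ δ ^ 2 = -(NumberField.discr K : ℂ)) →
      IsKatzMeasure₂ ι' v vbar S κ κ' γ⁻¹ γ'⁻¹ θK⁻¹ Ω δ ((Ωp : unrIntegers p) : ℂ_[p]) G →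
      (∀ (J : ℤ_[p] →+* PadicComplexInt p),
        (∀ x : ℤ_[p], ((J x : PadicComplexInt p) : ℂ_[p]) = ((x : ℚ_[p]) : ℂ_[p])) →
        Associated (PowerSeries.map (PowerSeries.map J) g) G) →
      (g.map (PowerSeries.constantCoeff (R := ℤ_[p]))).map (IsLocalRing.residue ℤ_[p]) ≠ 0 →
    ∃ (ΩK' : ℂ) (Ωp' : ℂ_[p]) (Q : PowerSeries 𝓞_ℂ_[p]), ΩK' ≠ 0 ∧ ‖Ωp'‖ = 1 ∧
      (∀ (φ : HeckeCharacter K) (n : ℕ), 0 < n → (p - 1) ∣ n →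
        (∀ w : HeightOneSpectrum (𝓞 K), φ.IsUnramifiedAt w) →
        φ.HasInfinityType (fun _ ↦ (n : ℤ)) (fun _ ↦ -(n : ℤ)) →
        ∀ (hL : LFunction.HasEntireContinuation (heckeLFunction (θK * φ))),
        ∀ r : FramedGaloisRep K (PadicAlgCl p) 1, IsPAdicAvatarOf ι' φ r → FactorsThroughZp κ r →
          IntSeries.HasValueAt Q (avatarValueAt r γ - 1)
            (((ι'.symm (katzInterpolationValue p θK v vbar ∅ φ n ΩK' (hL.continuation 1)) :
                PadicAlgCl p) : ℂ_[p]) * Ωp' ^ (2 * n))) ∧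
      (‖((PowerSeries.coeff ((g.map (PowerSeries.constantCoeff (R := ℤ_[p]))).map
            (IsLocalRing.residue ℤ_[p])).order.toNat Q : 𝓞_ℂ_[p]) : ℂ_[p])‖ = 1 ∧
        ∀ i < ((g.map (PowerSeries.constantCoeff (R := ℤ_[p]))).map
            (IsLocalRing.residue ℤ_[p])).order.toNat,
          ‖((PowerSeries.coeff i Q : 𝓞_ℂ_[p]) : ℂ_[p])‖ < 1) := by
  intro hp hgood hred hanom hGL K _ _ hK _ _ _ _ ι v vbar hιv hvbar hne κ hκ γ hγ ι' hι' Φ hΦ θsub θquot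
    _ hquot θK hθK S hS κ' γ' hpair Ω δ Ωp G g hΩ hδ hG hJ hg0
  haveI : IsCMField K := hK.isCMField
  have hv : ((p : ℕ) : 𝓞 K) ∈ v.asIdeal := natCast_mem_asIdeal_of_norm_iff hιv
  obtain ⟨hfin, hgal, hθp⟩ := heckeCharOf_quotChar_finiteOrder_galConj_unramified W p hp hgood hred
    hanom hGL ι' hΦ hquot hθK
  have hassoc : Associated (PowerSeries.map (PowerSeries.map (R1.toCpInt p)) g) G :=
    hJ (R1.toCpInt p) (fun x ↦ R1.coe_toCpInt p x)
  exact exists_katzLineIntFrame hF hK hp hv hvbar hne hι' hκ hγ.out hpair hfin hgal (hθp v hv)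
    (hθp vbar hvbar) hS hΩ hδ hG (fun x ↦ R1.coe_toCpInt p x) hassoc hg0

end Summit.BirchSwinnertonDyer.BirchSwinnertonDyer.Theorems.KatzLineFrame

end
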